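import Mathlib.Analysis.SpecialFunctions.Trigonometric.Bounds
import Mathlib.Analysis.SpecialFunctions.Log.Basic
import Mathlib.Analysis.Real.Pi.Bounds
import Mathlib.Algebra.Order.Floor.Defs
import Mathlib.Algebra.BigOperators.Intervals
import HarnessLib

/-!
# The harmonic walk along one row of the torus (towards the Cooper logarithm on the torus)

Topic `MathematicalPhysics/QuantumLattice`. Pure real-analysis lemmas behind the elementary
lower bound `torusCooperSum L N (1/L) ≥ c log L` for the torus Cooper sum of
`TorusCooperSum.lean` (assembled in `TorusCooperSumLogBound.lean`). Along one row `k₂ = b` of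
the momentum grid `(ℤ/Lℤ)²` the free energies measured from the shell level are
`g(n) = -2cos(2πn/L) + c`, `c = -2cos(2πb/L) - μ_L`; a row is *good* when `|c| ≤ 2 - s²/2`,
i.e. it crosses the Fermi level transversally. Everything is PROVED:

* `log_sub_log_le_sum_Ico_one_div` — `log c - log a ≤ Σ_{a ≤ j < c} 1/j`;
* `le_sin_of_abs_cos_le` — on `[0, π]`, `|cos x| ≤ 1 - κ²` forces `sin x ≥ κ`;
* `cooperRow_increment_eq`, `abs_cooperRow_increment_le` —
  `g(n+1) - g(n) = 4 sin(π(2n+1)/L) sin(π/L) ∈ [-4π/L, 4π/L]`;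
* `exists_cooperRow_crossing` — for a good row and `L ≥ 400/s²` the first index `n₀ ≤ L/2` with
  `g(n₀) ≥ 0` has `g(n₀) < 4π/L` and `|cos(2πn₀/L)| ≤ 1 - s²/8`;
* `cooperRow_window_point`, `cooperRow_increment_ge`, `cooperRow_walk_bounds` — on the window
  `n₀ ≤ n ≤ n₀ + R`, `R ≤ s²L/64`, the increments are at least `s/L` (Jordan's inequality), so
  `s j/L ≤ g(n₀ + j) ≤ 4π(j+1)/L`;
* `cooperRow_sum_ge` — **the harmonic walk**: for `L ≥ 400/s²` and `L ≥ (128/s³)²`,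
  `Σ_{n < L, 1/L < |g(n)|} 1/(2|g(n)|) ≥ (L/(32π)) log L`.

The constants are not optimised. No torus object appears in this file (it imports Mathlib only);
the dictionary to `torusXi` is `TorusCooperSumLogBound.torusXi_vecCons`.

## References

* M. Salmhofer, *Renormalization: An Introduction*, Springer 1999, §4.5.4 (the Cooper logarithm
  `½N(0) log(βε₀/2)`, eq. (4.203), whose finite-torus analogue this walk produces). [Salmhofer1999]
-/

noncomputable section

open Finset

namespace Literature.MathematicalPhysics.QuantumLattice

/-! ### The walk -/

section RowWalk

open Real

/-- Harmonic tail versus logarithm: `log c - log a ≤ Σ_{a ≤ j < c} 1/j` (`1 ≤ a ≤ c`), from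
`log (1 + 1/j) ≤ 1/j`. [folklore] -/
theorem log_sub_log_le_sum_Ico_one_div {a c : ℕ} (ha : 1 ≤ a) (hac : a ≤ c) :
    Real.log c - Real.log a ≤ ∑ j ∈ Finset.Ico a c, (1 : ℝ) / j := by
  induction c, hac using Nat.le_induction with
  | base => simp
  | succ c hc ih =>
    rw [Finset.sum_Ico_succ_top hc, Nat.cast_succ]
    have hcpos : (0 : ℝ) < c := by exact_mod_cast (by omega : 0 < c)
    have hstep : Real.log (c + 1) - Real.log c ≤ 1 / c := by
      rw [← Real.log_div (by positivity) hcpos.ne']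
      have := Real.log_le_sub_one_of_pos (x := (c + 1) / c) (by positivity)
      have e : ((c : ℝ) + 1) / c - 1 = 1 / c := by field_simp; ring
      linarith
    linarith

/-- On `[0, π]`, `|cos x| ≤ 1 - κ²` forces `sin x ≥ κ` (`0 ≤ κ ≤ 1`):
`sin² x = (1 - |cos x|)(1 + |cos x|) ≥ κ²`. [folklore] -/
theorem le_sin_of_abs_cos_le {κ x : ℝ} (hκ : 0 ≤ κ) (hκ1 : κ ≤ 1) (hx0 : 0 ≤ x) (hxπ : x ≤ π)
    (h : |Real.cos x| ≤ 1 - κ ^ 2) : κ ≤ Real.sin x := by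
  have hsin : 0 ≤ Real.sin x := Real.sin_nonneg_of_nonneg_of_le_pi hx0 hxπ
  have hsq : Real.sin x ^ 2 = 1 - Real.cos x ^ 2 := Real.sin_sq x
  have hcos2 : Real.cos x ^ 2 ≤ (1 - κ ^ 2) ^ 2 := by
    rw [← sq_abs (Real.cos x)]
    exact pow_le_pow_left₀ (abs_nonneg _) h 2
  have hk4 : κ ^ 2 * κ ^ 2 ≤ κ ^ 2 := mul_le_of_le_one_right (sq_nonneg κ) (by nlinarith)
  have e : (1 - κ ^ 2) ^ 2 = 1 - 2 * κ ^ 2 + κ ^ 2 * κ ^ 2 := by ring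
  have hk2 : κ ^ 2 ≤ Real.sin x ^ 2 := by nlinarith
  nlinarith

/-- The increment of the row energy `g(n) = -2cos(2πn/L) + c` between consecutive momenta:
`g(n+1) - g(n) = 4 sin(π(2n+1)/L) sin(π/L)`. [folklore] -/
theorem cooperRow_increment_eq (L : ℕ) (c : ℝ) (n : ℕ) :
    (-2 * Real.cos (2 * π * ((n + 1 : ℕ) : ℝ) / L) + c) - (-2 * Real.cos (2 * π * (n : ℝ) / L) + c)
      = 4 * Real.sin (π * (2 * n + 1) / L) * Real.sin (π / L) := by
  have h := Real.cos_sub_cos (2 * π * (n : ℝ) / L) (2 * π * ((n + 1 : ℕ) : ℝ) / L)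
  have h1 : (2 * π * (n : ℝ) / L + 2 * π * ((n + 1 : ℕ) : ℝ) / L) / 2 = π * (2 * n + 1) / L := by
    push_cast; ring
  have h2 : (2 * π * (n : ℝ) / L - 2 * π * ((n + 1 : ℕ) : ℝ) / L) / 2 = -(π / L) := by
    push_cast; ring
  rw [h1, h2, Real.sin_neg] at h
  linarith

/-- The increments are at most `4π/L` in absolute value (`cos` is `1`-Lipschitz). [folklore] -/
theorem abs_cooperRow_increment_le (L : ℕ) (hL : 0 < L) (c : ℝ) (n : ℕ) :
    |(-2 * Real.cos (2 * π * ((n + 1 : ℕ) : ℝ) / L) + c) -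
        (-2 * Real.cos (2 * π * (n : ℝ) / L) + c)| ≤ 4 * π / L := by
  have hLr : (0 : ℝ) < L := by exact_mod_cast hL
  have h := Real.abs_cos_sub_cos_le (2 * π * ((n + 1 : ℕ) : ℝ) / L) (2 * π * (n : ℝ) / L)
  have h1 : |2 * π * ((n + 1 : ℕ) : ℝ) / L - 2 * π * (n : ℝ) / L| = 2 * π / L := by
    rw [show 2 * π * ((n + 1 : ℕ) : ℝ) / L - 2 * π * (n : ℝ) / L = 2 * π / L by push_cast; ring]
    exact abs_of_pos (by positivity)
  rw [h1] at h
  calc |(-2 * Real.cos (2 * π * ((n + 1 : ℕ) : ℝ) / L) + c) -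
        (-2 * Real.cos (2 * π * (n : ℝ) / L) + c)|
      = 2 * |Real.cos (2 * π * ((n + 1 : ℕ) : ℝ) / L) - Real.cos (2 * π * (n : ℝ) / L)| := by
        rw [show (-2 * Real.cos (2 * π * ((n + 1 : ℕ) : ℝ) / L) + c) -
            (-2 * Real.cos (2 * π * (n : ℝ) / L) + c) =
            (-2) * (Real.cos (2 * π * ((n + 1 : ℕ) : ℝ) / L) - Real.cos (2 * π * (n : ℝ) / L))
            by ring, abs_mul]
        norm_num
    _ ≤ 2 * (2 * π / L) := by gcongr
    _ = 4 * π / L := by ring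

/-- **The crossing.** For `|c| ≤ 2 - s²/2`, `0 < s ≤ 1` and `L ≥ 400/s²`, the row energy
`g(n) = -2cos(2πn/L) + c` (negative at `n = 0`, non-negative at `n = ⌊L/2⌋`) first becomes
non-negative at some `1 ≤ n₀ ≤ L/2`, where `0 ≤ g(n₀) < 4π/L` and `|cos(2πn₀/L)| ≤ 1 - s²/8`.
[folklore] -/
theorem exists_cooperRow_crossing {L : ℕ} {s c : ℝ} (hs : 0 < s) (hs1 : s ≤ 1)
    (hc : |c| ≤ 2 - s ^ 2 / 2) (hL : 400 / s ^ 2 ≤ (L : ℝ)) :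
    ∃ n₀ : ℕ, 1 ≤ n₀ ∧ 2 * n₀ ≤ L ∧ 0 ≤ -2 * Real.cos (2 * π * (n₀ : ℝ) / L) + c ∧
      -2 * Real.cos (2 * π * (n₀ : ℝ) / L) + c < 4 * π / L ∧
      |Real.cos (2 * π * (n₀ : ℝ) / L)| ≤ 1 - s ^ 2 / 8 := by
  have hπ := Real.pi_pos
  have hπ3 := Real.pi_lt_d2
  have hs2 : 0 < s ^ 2 := by positivity
  have hL1 : (1 : ℝ) ≤ L := by
    have : (400 : ℝ) ≤ 400 / s ^ 2 := by
      rw [le_div_iff₀ hs2]; nlinarith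
    linarith
  have hLpos : 0 < L := by exact_mod_cast (show (0 : ℝ) < L by linarith)
  have hLr : (0 : ℝ) < L := by exact_mod_cast hLpos
  have hsL : 400 ≤ s ^ 2 * L := by rwa [div_le_iff₀ hs2, mul_comm] at hL
  rw [abs_le] at hc
  -- `g(m) ≥ 0` at `m = L / 2`
  set m : ℕ := L / 2 with hm
  obtain ⟨r, hr, hLmr⟩ : ∃ r : ℕ, r ≤ 1 ∧ L = 2 * m + r := ⟨L % 2, by omega, by omega⟩
  have hgm : 0 ≤ -2 * Real.cos (2 * π * (m : ℝ) / L) + c := by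
    have hangle : 2 * π * (m : ℝ) / L = π - π * r / L := by
      have : (L : ℝ) = 2 * m + r := by exact_mod_cast hLmr
      field_simp
      rw [this]
      ring
    rw [hangle, Real.cos_pi_sub]
    -- `cos(πr/L) ≥ cos(π/L) ≥ 1 - π²/(2L²)`
    have h1 : Real.cos (π / L) ≤ Real.cos (π * r / L) := by
      apply Real.cos_le_cos_of_nonneg_of_le_pi (by positivity)
      · rw [div_le_iff₀ hLr]; nlinarith
      · have : (r : ℝ) ≤ 1 := by exact_mod_cast hr
        rw [div_le_div_iff_of_pos_right hLr]
        nlinarith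
    have h2 := Real.one_sub_sq_div_two_le_cos (x := π / L)
    have h3 : (π / L) ^ 2 ≤ s ^ 2 / 2 := by
      rw [div_pow, div_le_iff₀ (by positivity)]
      have : π ^ 2 ≤ s ^ 2 / 2 * L := by nlinarith
      nlinarith
    have key : 2 - s ^ 2 / 2 ≤ 2 * Real.cos (π * r / L) := by nlinarith
    nlinarith
  -- the first non-negative index
  classical
  have hex : ∃ n : ℕ, 0 ≤ -2 * Real.cos (2 * π * (n : ℝ) / L) + c := ⟨m, hgm⟩
  refine ⟨Nat.find hex, ?_, ?_, Nat.find_spec hex, ?_, ?_⟩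
  · rw [Nat.one_le_iff_ne_zero]
    intro h0
    have := Nat.find_spec hex
    rw [h0] at this
    simp only [Nat.cast_zero, mul_zero, zero_div, Real.cos_zero, mul_one] at this
    nlinarith
  · have := Nat.find_min' hex hgm
    omega
  · -- `g(n₀) < g(n₀ - 1) + 4π/L < 4π/L`
    have h0 : Nat.find hex ≠ 0 := by
      intro h0
      have := Nat.find_spec hex
      rw [h0] at this
      simp only [Nat.cast_zero, mul_zero, zero_div, Real.cos_zero, mul_one] at this
      nlinarith
    obtain ⟨k, hk⟩ : ∃ k, Nat.find hex = k + 1 := Nat.exists_eq_succ_of_ne_zero h0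
    have hneg : ¬ 0 ≤ -2 * Real.cos (2 * π * (k : ℝ) / L) + c := Nat.find_min hex (by omega)
    push Not at hneg
    have hinc := abs_cooperRow_increment_le L hLpos c k
    rw [abs_le] at hinc
    rw [hk]
    linarith [hinc.2]
  · -- `|2 cos| = |c - g(n₀)| ≤ |c| + 4π/L ≤ 2 - s²/4`
    have hg0 := Nat.find_spec hex
    have hg1 : -2 * Real.cos (2 * π * ((Nat.find hex : ℕ) : ℝ) / L) + c < 4 * π / L := by
      -- same as the previous bullet
      have h0 : Nat.find hex ≠ 0 := by
        intro h0
        have := Nat.find_spec hex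
        rw [h0] at this
        simp only [Nat.cast_zero, mul_zero, zero_div, Real.cos_zero, mul_one] at this
        nlinarith
      obtain ⟨k, hk⟩ : ∃ k, Nat.find hex = k + 1 := Nat.exists_eq_succ_of_ne_zero h0
      have hneg : ¬ 0 ≤ -2 * Real.cos (2 * π * (k : ℝ) / L) + c := Nat.find_min hex (by omega)
      push Not at hneg
      have hinc := abs_cooperRow_increment_le L hLpos c k
      rw [abs_le] at hinc
      rw [hk]
      linarith [hinc.2]
    have h4 : 4 * π / L ≤ s ^ 2 / 4 := by
      rw [div_le_iff₀ hLr]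
      nlinarith
    rw [abs_le]
    constructor <;> linarith


/-- **Window geometry.** From a point `x₀ ∈ [0, π]` with `|cos x₀| ≤ 1 - s²/8`, moving right by
`t ≤ 7s²/64` stays in `[0, π]` (since `π - x₀ ≥ s/2`) and keeps `|cos| ≤ 1 - s²/64`. [folklore] -/
theorem cooperRow_window_point {s x₀ t : ℝ} (hs : 0 < s) (hs1 : s ≤ 1) (hx0 : 0 ≤ x₀) (hxπ : x₀ ≤ π)
    (hcos : |Real.cos x₀| ≤ 1 - s ^ 2 / 8) (ht0 : 0 ≤ t) (ht : t ≤ 7 * s ^ 2 / 64) :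
    0 ≤ x₀ + t ∧ x₀ + t ≤ π ∧ |Real.cos (x₀ + t)| ≤ 1 - s ^ 2 / 64 := by
  refine ⟨by positivity, ?_, ?_⟩
  · have h1 := Real.one_sub_sq_div_two_le_cos (x := π - x₀)
    rw [Real.cos_pi_sub] at h1
    have h2 : -Real.cos x₀ ≤ 1 - s ^ 2 / 8 := (neg_le_abs _).trans hcos
    have h3 : (s / 2) ^ 2 ≤ (π - x₀) ^ 2 := by nlinarith
    have h4 : s / 2 ≤ π - x₀ :=
      (pow_le_pow_iff_left₀ (by positivity) (sub_nonneg.mpr hxπ) two_ne_zero).mp h3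
    have h5 : t ≤ s / 2 := by nlinarith
    linarith
  · have h := Real.abs_cos_sub_cos_le (x₀ + t) x₀
    rw [add_sub_cancel_left, abs_of_nonneg ht0] at h
    have := abs_sub_abs_le_abs_sub (Real.cos (x₀ + t)) (Real.cos x₀)
    linarith

/-- **Increments in the window are at least `s/L`.** For `n₀ ≤ n < n₀ + R`, `R ≤ s²L/64`,
`2n₀ ≤ L`, `|cos(2πn₀/L)| ≤ 1 - s²/8` and `L ≥ 400/s²`:
`g(n+1) - g(n) = 4 sin(π(2n+1)/L) sin(π/L) ≥ 4 · (s/8) · (2/L)`. [folklore] -/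
theorem cooperRow_increment_ge {L : ℕ} {s : ℝ} (c : ℝ) {n₀ R n : ℕ} (hs : 0 < s) (hs1 : s ≤ 1)
    (hL : 400 / s ^ 2 ≤ (L : ℝ)) (hn₀ : 2 * n₀ ≤ L)
    (hcos : |Real.cos (2 * π * (n₀ : ℝ) / L)| ≤ 1 - s ^ 2 / 8)
    (hR : (R : ℝ) ≤ s ^ 2 * L / 64) (hn1 : n₀ ≤ n) (hn2 : n < n₀ + R) :
    s / L ≤ (-2 * Real.cos (2 * π * ((n + 1 : ℕ) : ℝ) / L) + c) -
      (-2 * Real.cos (2 * π * (n : ℝ) / L) + c) := by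
  have hπ := Real.pi_pos
  have hπ3 := Real.pi_lt_d2
  have hs2 : 0 < s ^ 2 := by positivity
  have hsL : 400 ≤ s ^ 2 * L := by rwa [div_le_iff₀ hs2, mul_comm] at hL
  have hL1 : (2 : ℝ) ≤ L := by nlinarith
  have hLr : (0 : ℝ) < L := by linarith
  rw [cooperRow_increment_eq]
  -- the midpoint `π(2n+1)/L = x₀ + t`
  set x₀ : ℝ := 2 * π * (n₀ : ℝ) / L with hx₀
  set t : ℝ := π * (2 * ((n : ℝ) - n₀) + 1) / L with ht
  have hmid : π * (2 * (n : ℝ) + 1) / L = x₀ + t := by rw [hx₀, ht]; field_simp; ring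
  have hx00 : 0 ≤ x₀ := by positivity
  have hx0π : x₀ ≤ π := by
    rw [hx₀, div_le_iff₀ hLr]
    have : 2 * (n₀ : ℝ) ≤ L := by exact_mod_cast hn₀
    nlinarith
  have hnn : (n₀ : ℝ) ≤ n := by exact_mod_cast hn1
  have hnR : (n : ℝ) + 1 ≤ n₀ + R := by exact_mod_cast hn2
  have ht0 : 0 ≤ t := by rw [ht]; apply div_nonneg _ hLr.le; nlinarith
  have ht1 : t ≤ 7 * s ^ 2 / 64 := by
    rw [ht, div_le_iff₀ hLr]
    have h1 : π * (2 * ((n : ℝ) - n₀) + 1) ≤ π * (2 * R - 1) := by nlinarith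
    have h2 : π * (2 * (R : ℝ) - 1) ≤ π * (s ^ 2 * L / 32) := by nlinarith
    nlinarith
  obtain ⟨hm0, hmπ, hmcos⟩ := cooperRow_window_point hs hs1 hx00 hx0π hcos ht0 ht1
  have hsin1 : s / 8 ≤ Real.sin (x₀ + t) :=
    le_sin_of_abs_cos_le (by positivity) (by linarith) hm0 hmπ
      (by rw [show (s / 8) ^ 2 = s ^ 2 / 64 by ring]; exact hmcos)
  have hsin2 : 2 / L ≤ Real.sin (π / L) := by
    have := Real.mul_le_sin (x := π / L) (by positivity)
      (by rw [div_le_div_iff_of_pos_left hπ hLr two_pos]; exact hL1)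
    rwa [show 2 / π * (π / L) = 2 / L by field_simp] at this
  rw [hmid]
  have hprod : (s / 8) * (2 / L) ≤ Real.sin (x₀ + t) * Real.sin (π / L) :=
    mul_le_mul hsin1 hsin2 (by positivity) (le_trans (by positivity) hsin1)
  calc s / L = 4 * ((s / 8) * (2 / L)) := by ring
    _ ≤ 4 * (Real.sin (x₀ + t) * Real.sin (π / L)) := by linarith
    _ = _ := by ring

/-- **Cumulative bounds along the walk**: for `j ≤ R`,
`s j / L ≤ g(n₀ + j)` and `g(n₀ + j) ≤ 4π(j+1)/L`. [folklore] -/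
theorem cooperRow_walk_bounds {L : ℕ} {s c : ℝ} {n₀ R : ℕ} (hs : 0 < s) (hs1 : s ≤ 1)
    (hL : 400 / s ^ 2 ≤ (L : ℝ)) (hn₀ : 2 * n₀ ≤ L)
    (hcos : |Real.cos (2 * π * (n₀ : ℝ) / L)| ≤ 1 - s ^ 2 / 8)
    (hR : (R : ℝ) ≤ s ^ 2 * L / 64)
    (hg0 : 0 ≤ -2 * Real.cos (2 * π * (n₀ : ℝ) / L) + c)
    (hg1 : -2 * Real.cos (2 * π * (n₀ : ℝ) / L) + c < 4 * π / L) {j : ℕ} (hj : j ≤ R) :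
    s * j / L ≤ -2 * Real.cos (2 * π * ((n₀ + j : ℕ) : ℝ) / L) + c ∧
      -2 * Real.cos (2 * π * ((n₀ + j : ℕ) : ℝ) / L) + c ≤ 4 * π * (j + 1) / L := by
  have hs2 : 0 < s ^ 2 := by positivity
  have hsL : 400 ≤ s ^ 2 * L := by rwa [div_le_iff₀ hs2, mul_comm] at hL
  have hLpos : 0 < L := by
    have : (0 : ℝ) < L := by nlinarith
    exact_mod_cast this
  induction j with
  | zero =>
    simp only [add_zero, Nat.cast_zero, mul_zero, zero_div, zero_add, mul_one]
    exact ⟨hg0, hg1.le⟩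
  | succ j ih =>
    obtain ⟨ih1, ih2⟩ := ih (by omega)
    have hinc1 := cooperRow_increment_ge c hs hs1 hL hn₀ hcos hR (n := n₀ + j) (by omega) (by omega)
    have hinc2 := abs_cooperRow_increment_le L hLpos c (n₀ + j)
    rw [abs_le] at hinc2
    rw [show n₀ + (j + 1) = n₀ + j + 1 by ring]
    push_cast at ih1 ih2 hinc1 hinc2 ⊢
    constructor
    · have e : s * ((j : ℝ) + 1) / L = s * j / L + s / L := by ring
      rw [e]
      linarith
    · have e : 4 * π * ((j : ℝ) + 1 + 1) / L = 4 * π * (j + 1) / L + 4 * π / L := by ring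
      rw [e]
      linarith [hinc2.2]


/-- **The harmonic walk along one row.** For `|c| ≤ 2 - s²/2`, `0 < s ≤ 1`, `L ≥ 400/s²` and
`L ≥ (128/s³)²`, the row energies `g(n) = -2cos(2πn/L) + c`, `0 ≤ n < L`, satisfy
`Σ_{n : 1/L < |g(n)|} 1/(2|g(n)|) ≥ (L/(32π)) log L`: to the right of the crossing `n₀` the
energies `g(n₀ + j)`, `j₀ ≤ j ≤ R ≈ s²L/64`, lie in `(1/L, 8πj/L]`, and `Σ 1/j ≳ log L`.
[folklore] -/
theorem cooperRow_sum_ge {L : ℕ} {s c : ℝ} (g : ℕ → ℝ)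
    (hg : ∀ n : ℕ, g n = -2 * Real.cos (2 * π * (n : ℝ) / L) + c) (hs : 0 < s) (hs1 : s ≤ 1)
    (hc : |c| ≤ 2 - s ^ 2 / 2) (hL : 400 / s ^ 2 ≤ (L : ℝ)) (hL2 : (128 / s ^ 3) ^ 2 ≤ (L : ℝ)) :
    (L : ℝ) / (32 * π) * Real.log L ≤
      ∑ n ∈ (Finset.range L).filter (fun n : ℕ => 1 / (L : ℝ) < |g n|), 1 / (2 * |g n|) := by
  have hπ := Real.pi_pos
  have hs2 : 0 < s ^ 2 := by positivity
  have hs3 : 0 < s ^ 3 := by positivity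
  have hsL : 400 ≤ s ^ 2 * L := by rwa [div_le_iff₀ hs2, mul_comm] at hL
  have hLr : (0 : ℝ) < L := by nlinarith
  obtain ⟨n₀, hn₀1, hn₀L, hg0, hg1, hcos⟩ := exists_cooperRow_crossing hs hs1 hc hL
  -- the length of the walk and its first index
  set R : ℕ := ⌊s ^ 2 * L / 64⌋₊ with hR
  have hRle : (R : ℝ) ≤ s ^ 2 * L / 64 := Nat.floor_le (by positivity)
  have hRge : s ^ 2 * L / 64 < R + 1 := Nat.lt_floor_add_one _
  set j₀ : ℕ := ⌊1 / s⌋₊ + 1 with hj₀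
  have hj₀gt : 1 / s < j₀ := by rw [hj₀]; push_cast; exact Nat.lt_floor_add_one _
  have hj₀le : (j₀ : ℝ) ≤ 2 / s := by
    rw [hj₀]; push_cast
    have h1 : (⌊1 / s⌋₊ : ℝ) ≤ 1 / s := Nat.floor_le (by positivity)
    have h2 : (1 : ℝ) ≤ 1 / s := by rw [le_div_iff₀ hs]; linarith
    have h3 : 2 / s = 1 / s + 1 / s := by ring
    linarith
  have hj₀pos : 1 ≤ j₀ := by rw [hj₀]; omega
  -- numerics: `2/s ≤ s²L/64`
  have hsL3 : 16384 ≤ s ^ 3 * L := by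
    have h1 : s ^ 3 * (128 / s ^ 3) ^ 2 ≤ s ^ 3 * L := by gcongr
    have h2 : s ^ 3 * (128 / s ^ 3) ^ 2 = 16384 / s ^ 3 := by field_simp; ring
    have hs3le : s ^ 3 ≤ 1 := by nlinarith
    have h3 : (16384 : ℝ) ≤ 16384 / s ^ 3 := by rw [le_div_iff₀ hs3]; nlinarith
    linarith
  have h2s : 2 / s ≤ s ^ 2 * L / 64 := by
    rw [div_le_div_iff₀ hs (by norm_num)]; nlinarith
  have hj₀R : j₀ ≤ R + 1 := by
    have : (j₀ : ℝ) ≤ R + 1 := by linarith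
    exact_mod_cast this
  -- along the walk the energies lie in `(1/L, 8πj/L]`
  have hwalk : ∀ j ∈ Finset.Icc j₀ R, 1 / (L : ℝ) < g (n₀ + j) ∧ g (n₀ + j) ≤ 8 * π * j / L := by
    intro j hj
    rw [Finset.mem_Icc] at hj
    obtain ⟨hb1, hb2⟩ := cooperRow_walk_bounds (c := c) hs hs1 hL hn₀L hcos hRle hg0 hg1 hj.2
    rw [← hg (n₀ + j)] at hb1 hb2
    have hj1 : (j₀ : ℝ) ≤ j := by exact_mod_cast hj.1
    have hj1' : (1 : ℝ) ≤ j := le_trans (by exact_mod_cast hj₀pos) hj1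
    constructor
    · have h1 : 1 < s * j := by
        have : s * (1 / s) = 1 := by field_simp
        nlinarith
      calc 1 / (L : ℝ) < s * j / L := by gcongr
        _ ≤ g (n₀ + j) := hb1
    · calc g (n₀ + j) ≤ 4 * π * (j + 1) / L := hb2
        _ ≤ 8 * π * j / L := by
            rw [div_le_div_iff_of_pos_right hLr]
            nlinarith
  -- the walk lies in the summation range
  have hsub : (Finset.Icc j₀ R).image (fun j => n₀ + j) ⊆
      (Finset.range L).filter (fun n : ℕ => 1 / (L : ℝ) < |g n|) := by
    intro n hn
    rw [Finset.mem_image] at hn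
    obtain ⟨j, hj, rfl⟩ := hn
    obtain ⟨h1, h2⟩ := hwalk j hj
    rw [Finset.mem_filter, Finset.mem_range]
    rw [Finset.mem_Icc] at hj
    constructor
    · have hjL : (j : ℝ) ≤ L / 64 := by
        calc (j : ℝ) ≤ R := by exact_mod_cast hj.2
          _ ≤ s ^ 2 * L / 64 := hRle
          _ ≤ 1 * L / 64 := by gcongr; nlinarith
          _ = L / 64 := by ring
      have h2n : 2 * (n₀ : ℝ) ≤ L := by exact_mod_cast hn₀L
      have : (n₀ : ℝ) + j < L := by linarith
      exact_mod_cast this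
    · rwa [abs_of_pos (lt_trans (by positivity) h1)]
  have hinj : Set.InjOn (fun j => n₀ + j) ↑(Finset.Icc j₀ R) := fun a _ b _ h => by
    simpa using h
  -- the logarithm
  have hlog : Real.log L / 2 ≤ Real.log (R + 1) - Real.log j₀ := by
    have hA : Real.log (s ^ 2 * L / 64) ≤ Real.log (R + 1) :=
      Real.log_le_log (by positivity) hRge.le
    have hB : Real.log j₀ ≤ Real.log (2 / s) :=
      Real.log_le_log (by exact_mod_cast (show 0 < j₀ by omega)) hj₀le
    have hC : Real.log (s ^ 2 * L / 64) - Real.log (2 / s) =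
        Real.log L - Real.log (128 / s ^ 3) := by
      rw [← Real.log_div (by positivity) (by positivity), ← Real.log_div (by positivity)
        (by positivity)]
      congr 1
      field_simp
      ring
    have hD : Real.log ((128 / s ^ 3) ^ 2) ≤ Real.log L := Real.log_le_log (by positivity) hL2
    rw [Real.log_pow] at hD
    push_cast at hD
    linarith
  -- the chain
  calc (L : ℝ) / (32 * π) * Real.log L
      = (L : ℝ) / (16 * π) * (Real.log L / 2) := by ring
    _ ≤ (L : ℝ) / (16 * π) * (Real.log (R + 1) - Real.log j₀) := by gcongr
    _ ≤ (L : ℝ) / (16 * π) * ∑ j ∈ Finset.Icc j₀ R, (1 : ℝ) / j := by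
        gcongr
        rw [show Finset.Icc j₀ R = Finset.Ico j₀ (R + 1) by ext; simp]
        have := log_sub_log_le_sum_Ico_one_div hj₀pos hj₀R
        push_cast at this
        exact this
    _ = ∑ j ∈ Finset.Icc j₀ R, (L : ℝ) / (16 * π) * (1 / j) := by rw [Finset.mul_sum]
    _ ≤ ∑ j ∈ Finset.Icc j₀ R, 1 / (2 * |g (n₀ + j)|) := by
        refine Finset.sum_le_sum fun j hj => ?_
        obtain ⟨h1, h2⟩ := hwalk j hj
        have hgpos : 0 < g (n₀ + j) := lt_trans (by positivity) h1
        have hjpos : (0 : ℝ) < j := by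
          rw [Finset.mem_Icc] at hj
          exact_mod_cast (show 0 < j by omega)
        rw [abs_of_pos hgpos, show (L : ℝ) / (16 * π) * (1 / j) = L / (16 * π * j) by field_simp,
          div_le_div_iff₀ (by positivity) (by positivity)]
        rw [le_div_iff₀ hLr] at h2
        nlinarith
    _ = ∑ n ∈ (Finset.Icc j₀ R).image (fun j => n₀ + j), 1 / (2 * |g n|) := by
        rw [Finset.sum_image hinj]
    _ ≤ ∑ n ∈ (Finset.range L).filter (fun n : ℕ => 1 / (L : ℝ) < |g n|), 1 / (2 * |g n|) :=
        Finset.sum_le_sum_of_subset_of_nonneg hsub fun _ _ _ => by positivity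

end RowWalk

end Literature.MathematicalPhysics.QuantumLattice
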